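import Mathlib
import Literature.MathematicalPhysics.QuantumFieldTheory.Dimock2011to13.PolydiscCauchyBounds
import Literature.MathematicalPhysics.QuantumFieldTheory.Balaban1983to89.B14Eq362KernelWard
import Literature.MathematicalPhysics.QuantumFieldTheory.Balaban1983to89.B14Eq243PointCount
import Literature.MathematicalPhysics.QuantumFieldTheory.Balaban1983to89.B12Ward414

/-!
# `Balaban1983to89.B14.Eq350KernelCauchy` — T. Bałaban, *Convergent renormalization expansions for lattice gauge theories*,
# Commun. Math. Phys. **119** (1988) 243–285 [Balaban1988Convergent]: the bound on the second-derivative kernel (3.50)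
# `𝐄^{(2)}_{μν}(X, x, y, z)` FROM the printed inductive properties (2.27)(ii) (analytic extension) and (iv) ((I.1.18)) by the
# Cauchy estimate — the input `hbd` of `B14.Eq357KernelDecay`/`B14.Eq362KernelWard` DERIVED, their input `hloc` ((2.27)(i))
# holding by construction

statement-level skeleton of published theorems with citation tags; proofs where landed; nothing here is a claim about the Yang–Mills mass gap

PDF held: `paper:balaban1988-cmp119-convergent-renormalization` (journal page = PDF page + 242); p. 259 [PDF 17] and pp. 280–281
[PDF 38–39] re-read as images on the x2 renders `…-p017-x2.png`, `…-p038-x2.png`, `…-p039-x2.png` of the cell `pub-balaban`.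

CITATION HEADER (lean-in-tree rule).  WHAT IS REPRODUCED, verbatim.  [Balaban1988Convergent] (2.27) p. 259: *"The term
𝐄^{(j)}(X, U_k, z) of the last sum has the following properties: (i) it depends on U_k restricted to X; (ii) there exists an
analytic function 𝐄^{(j)}(X, (𝐔, 𝐉), z) of the variables (𝐔, 𝐉) ∈ U_j^c(X, α_{0,j}, α_{1,j}), which is an extension of this term,
i.e., the equality (I.1.9) is satisfied; (iii) the extended function is invariant with respect to the gauge transformations
(I.1.10); (iv) it satisfies the inequality (I.1.18)."*; (3.50) p. 280: *"𝐄^{(2)}_{μν}(X, x, y, z) = (δ²/δB_μ(x)δB_ν(y)) 𝐄^{(j)}(X,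
U_j(exp iB), z)|_{B=0}"*; p. 281: *"the function Π^{(j)}_{μν}(x, y, z) is given by the formula (3.50), but with 𝐄^{(j)}(X, U_j,
z) replaced by 𝐄^{(j)}(U_j, z) defined on the whole lattice L⁻ʲZ^d"*.  [Balaban1987RG1] (1.18) p. 261: *"|𝐄^{(j)}(X, U′U_k(X))|
≦ E₀ exp(−κd_j(X))"*.

SKELETON rows (owner r11): **B14.Eq3.49–3.50**, **B14.Eq3.62–3.64**.  State of the chain: `B14.Eq357KernelDecay.decay3_threeKernel`
and `B14.Eq362KernelWard.eq364_threeKernel_of_ward` take the per-domain kernels `K X = 𝐄^{(2)}(X, ·, ·, z)` with TWO hypotheses —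
locality (2.27)(i) `hloc` and the kernel bound `hbd` *"|K X μ ν x y| ≤ E₂e^{−κd_j(X)}"* (the printed (1.18) is for the FUNCTION;
`B14.Eq357KernelDecay` (M3″): *"its second B-derivative obeys the same decay with a Cauchy constant E₂, which is the input
displayed"*).  THIS FILE constructs `K` from the printed data and PROVES both: for every localization domain `X` an analytic
function `g X` ((2.27)(ii)) of the scalar bond components `(B_μ(x))`, `x` a site of a cube of `X` ((2.27)(i): the term depends on
`U_k` restricted to `X`), on an open set containing the closed polydisc of radius `R` about `B = 0`, bounded there by
`E₀e^{−κd_j(X)}` ((2.27)(iv) = (I.1.18) on the analyticity domain):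
* §1 `norm_pderiv_pderiv_zero_le` — the SECOND-ORDER CAUCHY ESTIMATE at the centre of a polydisc, diagonal included:
  `‖∂_a∂_b g(0)‖ ≤ 4A/R²` for `g` analytic near the closed polydisc of radius `R` with `‖g‖ ≤ A` there (two applications of
  `Dimock2011to13.PolydiscCauchyBounds.norm_pderiv_le` with the intermediate radius `R/2`; the tree's `norm_mixedDeriv_le` needs
  distinct coordinates);
* §2 `sites M X` (the sites of the cubes of `X`, via `B14.Eq243PointCount.blockSites`), `mem_sites`;
* §3 **`kernelOf M g`** — the kernel (3.50) of the family: `Re ∂_{(μ,x)}∂_{(ν,y)} (g X)(0)` when the cubes of `x`, `y` are cubes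
  of `X`, `0` otherwise; **`kernelOf_loc`** ((2.27)(i) for the kernel, by construction) and **`kernelOf_bound`**
  (`|K X μ ν x y| ≤ 4E₀R⁻²·e^{−κd_j(X)}` — `hbd` with `E₂ = 4E₀/R²`);
* §4 **`decay3_kernelOf`** (`B14.Eq364Beta.Decay3` for the whole-lattice kernel `threeKernel M (kernelOf M g)` with constants
  `(4E₀/R²)K₀(4·2^d, 2d)e^{4κ/3}`, `κ/(3dM)`) and **`eq364_kernelOf_of_ward`** (`β′_j = β_j` for it from translation
  invariance, per-domain (I.4.15)₁ in kernel Ward form, [I]'s Taylor data — `B14.Eq362KernelWard.eq364_threeKernel_of_ward` with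
  `hloc`, `hbd` discharged);
* §5 (2.27)(iii) for the kernel: `gaugeDir` (the pure-gauge direction `∂λ` on the bond components), `hessian_gaugeDir_eq_zero`
  ([I] (4.9) ⇒ (4.13) for the linearized gauge transformations `B ↦ B + t∂λ`, via `B12Ward414`), **`wardY_kernelOf`**,
  **`wardX_kernelOf`** (the kernel Ward identities `hwardY`/`hwardX` of `B14.Eq362KernelWard` DERIVED from local invariance
  of `g X`), and **`eq364_kernelOf`**: `β′_j = β_j` with `hloc`, `hbd`, `hwardY`, `hwardX` ALL DISCHARGED to the per-domain
  data (2.27)(i)–(iv) — remaining inputs: translation invariance (p. 281) and [I]'s Taylor data (I.5.16).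
Model notes (declared).  (M5) the analyticity space `U_j^c(X, α_{0,j}, α_{1,j})` of [I] (1.8) is modelled by an open set of
complex bond-component configurations over the sites of `X` containing the closed polydisc `{|B_μ(x)| ≤ R}` about the
background (`B = 0`); that the printed space contains such a polydisc (radius of order `α_{0,j}`) is [I]'s description of
`U_j^c`, not derived here.  (M6) the kernel (3.50) is modelled as `Re ∂_{(μ,x)}∂_{(ν,y)} g(0)` of the analytic extension (slice
derivatives `PolydiscCauchyBounds.pderiv`); for an extension real on real configurations this is the real second partial
derivative of (3.50) (`B14.Eq350Kernel.kernel350`) — the identification is not re-derived.  (M7) gauge invariance (2.27)(iii)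
enters LINEARIZED: local invariance of `g X` under `B ↦ B + t∂λ` in the scalar bond components (the abelian model of
`B14.Lem280Ward` (M1) / `wardY_kernel350_of_translate`; the non-abelian generator form with (I.4.14) is `B14.Lem280Ward.
wardY_kernel350`).  (M1′/M2′/M4″) blocks, sites and the infinite lattice as in `B14.Eq348ClassGeometry`/`B14.Eq357KernelDecay`.
Two `def`s with bodies per object; theorems; no `sorry`.

**Caveat (v1.1, located).**  In THIS file one analytic family `g X` (one kernel family `K X μ ν x y`, *"(any fixed z)"* —
model note (M1″) of `B14.Eq357KernelDecay`) serves every point `z` of `threeKernel M K μ ν x y z`; print's `𝐄^{(j)}(X, U_j, z)`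
depends on its point `z`.  For such `z`-INDEPENDENT families the hypothesis `hT : TranslInv (threeKernel M (kernelOf M g))`
of `eq364_kernelOf`/`eq364_kernelOf_of_ward` (invariance under ALL lattice translations) ties the kernel to the cube
partition — it fails, e.g., for every ultralocal family when `M > 1` — so these two theorems are to be read as the
`z`-independent special case of `B14.Eq358TranslInv.eq364_kernelPt`: there the family is `z`-pointed (`g X z`), the
whole-lattice kernel is `B14.Eq358TranslInv.kernelPt M g = (μ ν x y z) ↦ threeKernel M (kernelOf M (g · z)) μ ν x y z`, and
its translation invariance is PROVED from the density-level Euclidean covariance (2.29)/(3.58) (p. 260: *"We have it only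
for functions 𝐄^{(j)}(U_j, z) defined by the equality (2.27) with the unrestricted summation"*).  Every other theorem of this
file is a per-`z` statement and applies to pointed families verbatim (as `B14.Eq358TranslInv` does).

**Version.**  v1.1 — doc-only (this caveat); every declaration byte-identical to v1 (p255109).

Mega-formalization `lit-balaban`, unit `lit-balaban-r11` gen 6 (B14 fold owner), HOME `run/shared/lean/pub/lit-balaban/`.

## References
* [Balaban1988Convergent] T. Bałaban, Commun. Math. Phys. 119 (1988) 243–285, (2.27) p.259, (3.50) p.280, p.281.
* [Balaban1987RG1] T. Bałaban, Commun. Math. Phys. 109 (1987) 249–301 ([I]: (1.8)–(1.9) p.260, (1.18) p.261).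
* [Balaban1987RG1] (4.9) p.283, (4.13)–(4.15) p.284 (Ward identities; `B12Ward414`).
* [Dimock2013] J. Dimock, Rev. Math. Phys. 25 (2013) 1330010, §4.5 (polydisc Cauchy bounds; mechanism of `PolydiscCauchyBounds`).
-/

namespace Literature.MathematicalPhysics.QuantumFieldTheory.Balaban1983to89.B14.Eq350KernelCauchy

noncomputable section

open Literature.MathematicalPhysics.QuantumFieldTheory.Balaban1983to89
open Literature.MathematicalPhysics.QuantumFieldTheory.Balaban1983to89.B13ScaleTransfer
open Literature.MathematicalPhysics.QuantumFieldTheory.Balaban1983to89.TreeLength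
open Literature.MathematicalPhysics.QuantumFieldTheory.Balaban1983to89.B12TreeDecay
open Literature.MathematicalPhysics.QuantumFieldTheory.Balaban1983to89.B14.Eq364Beta
open Literature.MathematicalPhysics.QuantumFieldTheory.Balaban1983to89.B14.Eq357KernelDecay
open Literature.MathematicalPhysics.QuantumFieldTheory.Balaban1983to89.B14.Eq362KernelWard
open Literature.MathematicalPhysics.QuantumFieldTheory.Balaban1983to89.B14.Eq243PointCount (blockSites mem_blockSites)
open Literature.MathematicalPhysics.QuantumFieldTheory.Balaban1983to89.B14.Eq362Marginals (grad)
open Literature.MathematicalPhysics.QuantumFieldTheory.Dimock2011to13.PolydiscCauchyBounds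
open Literature.MathematicalPhysics.QuantumFieldTheory.GawedzkiKupiainen1985.PeriodicGleason (unitVec)
open _root_.Filter _root_.Topology Finset

variable {d : ℕ}

/-! ## §1. The second-order Cauchy estimate at the centre of a polydisc -/

/-- **Second-order Cauchy estimate** (the mechanism behind *"(iv) it satisfies the inequality (I.1.18)"* ⇒ a bound on the
kernel (3.50)): if `g` is analytic on an open set containing the closed polydisc `{|s_i| ≤ R}` (`R > 0`) and `‖g‖ ≤ A` there,
then for ANY two coordinates `a`, `b` (equal or not) `‖∂_a∂_b g(0)‖ ≤ 4A/R²` — `∂_b g` is bounded by `A/(R − R/2)` on the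
polydisc with the `b`-radius shrunk to `R/2` (`norm_pderiv_le`), and is analytic, so `∂_a` of it at `0` is bounded by that over
the remaining `a`-radius `≥ R/2`. [cite: Balaban1988Convergent, (2.27)(iv) p.259, (3.50) p.280] -/
theorem norm_pderiv_pderiv_zero_le {ι : Type*} [Fintype ι] [DecidableEq ι] {U : Set (ι → ℂ)} (hU : IsOpen U)
    {g : (ι → ℂ) → ℂ} (hg : AnalyticOnNhd ℂ g U) {R A : ℝ} (hR : 0 < R) (hA0 : 0 ≤ A)
    (hRU : polydisc (fun _ : ι => R) ⊆ U) (hA : ∀ s ∈ polydisc (fun _ : ι => R), ‖g s‖ ≤ A) (a b : ι) :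
    ‖pderiv a (pderiv b g) 0‖ ≤ 4 * A / R ^ 2 := by
  -- step 1: the first derivative on the polydisc with the `b`-radius shrunk to `R/2`
  set ρ' : ι → ℝ := Function.update (fun _ : ι => R) b (R / 2) with hρ'
  have h1 : ∀ s ∈ polydisc ρ', ‖pderiv b g s‖ ≤ A / (R - R / 2) := fun s hs =>
    norm_pderiv_le hg hRU hA b (show R / 2 < R by linarith) hs
  -- step 2: the second derivative at the centre
  have hρ'le : ∀ j, ρ' j ≤ R := fun j => by
    by_cases hj : j = b
    · subst hj; simp [hρ']; linarith
    · simp [hρ', hj]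
  have hρ'ge : ∀ j, R / 2 ≤ ρ' j := fun j => by
    by_cases hj : j = b
    · subst hj; simp [hρ']
    · simp [hρ', hj]; linarith
  have hρ'U : polydisc ρ' ⊆ U := (polydisc_mono hρ'le).trans hRU
  have hg' : AnalyticOnNhd ℂ (pderiv b g) U := analyticOnNhd_pderiv hU hg b
  have h0 : (0 : ι → ℂ) ∈ polydisc (Function.update ρ' a 0) := by
    intro j
    simp only [Pi.zero_apply, norm_zero]
    by_cases hj : j = a
    · subst hj; simp
    · rw [Function.update_of_ne hj]; linarith [hρ'ge j]
  have h2 := norm_pderiv_le hg' hρ'U h1 a (lt_of_lt_of_le (half_pos hR) (hρ'ge a)) h0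
  have hA1 : 0 ≤ A / (R - R / 2) := div_nonneg hA0 (by linarith)
  calc ‖pderiv a (pderiv b g) 0‖ ≤ A / (R - R / 2) / (ρ' a - 0) := h2
    _ ≤ A / (R - R / 2) / (R / 2) := by
        rw [sub_zero]
        exact div_le_div_of_nonneg_left hA1 (half_pos hR) (hρ'ge a)
    _ = 4 * A / R ^ 2 := by
        field_simp
        ring

/-! ## §2. The sites of the cubes of a domain -/

/-- The sites of `T^{(j)}` lying in the cubes of `X` (blocks of `M^d` sites, `B14.Eq243PointCount.blockSites`) — the
variables on which a term localized in `X` depends ((2.27)(i) *"it depends on U_k restricted to X"*).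
[cite: Balaban1988Convergent, (2.27)(i) p.259] -/
def sites (M : ℕ) (X : Finset (Pt d)) : Finset (Pt d) := X.biUnion (blockSites M)

/-- A site belongs to `sites M X` iff its cube is a cube of `X`. [cite: Balaban1988Convergent, (2.27)(i) p.259] -/
theorem mem_sites {M : ℕ} (hM : 0 < M) {X : Finset (Pt d)} {x : Pt d} : x ∈ sites M X ↔ coarse M x ∈ X := by
  unfold sites
  rw [mem_biUnion]
  constructor
  · rintro ⟨c, hc, hx⟩
    rw [(mem_blockSites hM).1 hx]
    exact hc
  · intro h
    exact ⟨coarse M x, h, (mem_blockSites hM).2 rfl⟩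

/-! ## §3. The kernel of an analytic localized family: locality and the Cauchy bound -/

/-- **The kernel (3.50) of an analytic localized family**: `g X` = the analytic extension (2.27)(ii) of `B ↦ 𝐄^{(j)}(X,
U_j(exp iB), z)` as a function of the scalar bond components `B_μ(x)`, `(μ, x) ∈ Fin d × sites M X`; the kernel is
`𝐄^{(2)}_{μν}(X, x, y, z) := Re ∂_{(μ,x)}∂_{(ν,y)} (g X)(0)` for sites `x`, `y` of the cubes of `X` and `0` otherwise (model note
M6). [cite: Balaban1988Convergent, (3.50) p.280] -/
def kernelOf (M : ℕ) (g : ∀ X : Finset (Pt d), (Fin d × ↥(sites M X) → ℂ) → ℂ) :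
    Finset (Pt d) → Fin d → Fin d → Pt d → Pt d → ℝ :=
  fun X μ ν x y => if h : x ∈ sites M X ∧ y ∈ sites M X then
      (pderiv (μ, (⟨x, h.1⟩ : ↥(sites M X))) (pderiv (ν, (⟨y, h.2⟩ : ↥(sites M X))) (g X)) 0).re else 0

variable {M : ℕ} {g : ∀ X : Finset (Pt d), (Fin d × ↥(sites M X) → ℂ) → ℂ}

/-- **(2.27)(i) for the kernel, BY CONSTRUCTION** — the hypothesis `hloc` of `B14.Eq357KernelDecay.decay3_threeKernel`:
the kernel vanishes unless the cubes of both sites are cubes of `X`. [cite: Balaban1988Convergent, (2.27)(i) p.259] -/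
theorem kernelOf_loc (hM : 0 < M) (X : Finset (Pt d)) (μ ν : Fin d) (x y : Pt d)
    (h : kernelOf M g X μ ν x y ≠ 0) : coarse M x ∈ X ∧ coarse M y ∈ X := by
  unfold kernelOf at h
  by_cases hxy : x ∈ sites M X ∧ y ∈ sites M X
  · exact ⟨(mem_sites hM).1 hxy.1, (mem_sites hM).1 hxy.2⟩
  · exact absurd (dif_neg hxy) h

/-- **THE KERNEL BOUND FROM (2.27)(ii) + (iv)** — the hypothesis `hbd` of `B14.Eq357KernelDecay.decay3_threeKernel` with
`E₂ = 4E₀/R²`: if every `g X` is analytic on an open set `U X` containing the closed polydisc of radius `R > 0` and bounded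
there by `E₀e^{−κd_j(X)}` ((I.1.18) on the analyticity domain), then `|𝐄^{(2)}_{μν}(X, x, y, z)| ≤ 4E₀R⁻²·e^{−κd_j(X)}`
(Cauchy, §1; `|Re w| ≤ ‖w‖`). [cite: Balaban1988Convergent, (2.27)(ii)(iv) p.259, (3.50) p.280] -/
theorem kernelOf_bound {U : ∀ X : Finset (Pt d), Set (Fin d × ↥(sites M X) → ℂ)} (hU : ∀ X, IsOpen (U X))
    (hg : ∀ X, AnalyticOnNhd ℂ (g X) (U X)) {R E₀ κ : ℝ} (hR : 0 < R) (hE₀ : 0 ≤ E₀)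
    (hRU : ∀ X, polydisc (fun _ => R) ⊆ U X)
    (hA : ∀ X : LocDom d, ∀ s ∈ polydisc (fun _ => R), ‖g X.1 s‖ ≤ E₀ * Real.exp (-κ * treeLen X.1))
    (X : LocDom d) (μ ν : Fin d) (x y : Pt d) :
    |kernelOf M g X.1 μ ν x y| ≤ 4 * E₀ / R ^ 2 * Real.exp (-κ * treeLen X.1) := by
  have hA0 : 0 ≤ E₀ * Real.exp (-κ * treeLen X.1) := mul_nonneg hE₀ (Real.exp_pos _).le
  unfold kernelOf
  by_cases hxy : x ∈ sites M X.1 ∧ y ∈ sites M X.1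
  · rw [dif_pos hxy]
    have hc := norm_pderiv_pderiv_zero_le (hU X.1) (hg X.1) hR hA0 (hRU X.1) (hA X) (μ, ⟨x, hxy.1⟩) (ν, ⟨y, hxy.2⟩)
    calc |(pderiv (μ, (⟨x, hxy.1⟩ : ↥(sites M X.1))) (pderiv (ν, (⟨y, hxy.2⟩ : ↥(sites M X.1))) (g X.1)) 0).re|
        ≤ ‖pderiv (μ, (⟨x, hxy.1⟩ : ↥(sites M X.1))) (pderiv (ν, (⟨y, hxy.2⟩ : ↥(sites M X.1))) (g X.1)) 0‖ :=
          Complex.abs_re_le_norm _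
      _ ≤ 4 * (E₀ * Real.exp (-κ * treeLen X.1)) / R ^ 2 := hc
      _ = 4 * E₀ / R ^ 2 * Real.exp (-κ * treeLen X.1) := by ring
  · rw [dif_neg hxy, abs_zero]
    exact mul_nonneg (div_nonneg (mul_nonneg (by norm_num) hE₀) (pow_nonneg hR.le 2)) (Real.exp_pos _).le

/-! ## §4. `Decay3` and (3.64) for the whole-lattice kernel of an analytic localized family -/

/-- **`Decay3` from (2.27)(i), (ii), (iv) and [II] (1.26) only**: the whole-lattice three-point kernel `threeKernel M (kernelOf M
g)` of an analytic localized family (polydisc radius `R`, bound `E₀e^{−κd_j(X)}`, `κ/3 ≥ κ₀(4·2^d, 2d)`) satisfies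
`B14.Eq364Beta.Decay3` with constants `(4E₀/R²)·K₀(4·2^d, 2d)·e^{4κ/3}` and rate `κ/(3dM)` —
`B14.Eq357KernelDecay.decay3_threeKernel` with `hloc`, `hbd` DISCHARGED. [cite: Balaban1988Convergent, (3.48) p.280, p.281 (the function Π^{(j)}_{μν}(x,y,z))] -/
theorem decay3_kernelOf (hM : 0 < M) {U : ∀ X : Finset (Pt d), Set (Fin d × ↥(sites M X) → ℂ)}
    (hU : ∀ X, IsOpen (U X)) (hg : ∀ X, AnalyticOnNhd ℂ (g X) (U X)) {R E₀ κ : ℝ} (hR : 0 < R) (hE₀ : 0 ≤ E₀)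
    (hRU : ∀ X, polydisc (fun _ => R) ⊆ U X)
    (hA : ∀ X : LocDom d, ∀ s ∈ polydisc (fun _ => R), ‖g X.1 s‖ ≤ E₀ * Real.exp (-κ * treeLen X.1))
    (hκ : kappa₀ (4 * 2 ^ d) (2 * d) ≤ κ / 3) (hκ0 : 0 ≤ κ) :
    Decay3 (threeKernel M (kernelOf M g)) (4 * E₀ / R ^ 2 * K₀ (4 * 2 ^ d) (2 * d) * Real.exp (4 * κ / 3))
      (κ / (3 * d * M)) :=
  decay3_threeKernel hM (div_nonneg (mul_nonneg (by norm_num) hE₀) (pow_nonneg hR.le 2)) hκ hκ0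
    (fun X μ ν x y h => kernelOf_loc hM X μ ν x y h) (kernelOf_bound hU hg hR hE₀ hRU hA)

/-- **`β′_j = β_j` ((3.61)–(3.64)) for the whole-lattice kernel of an analytic localized family** — `B14.Eq362KernelWard.
eq364_threeKernel_of_ward` with `hloc`, `hbd` DISCHARGED to (2.27)(i), (ii), (iv): the remaining inputs are translation
invariance (p. 281), the per-domain Ward identities (I.4.15)₁ in kernel form ((2.27)(iii)), and [I]'s Taylor data (I.5.16)
of the summed kernel (3.63). [cite: Balaban1988Convergent, (3.64) p.283] -/
theorem eq364_kernelOf_of_ward (hM : 0 < M) (hd : 0 < d) {U : ∀ X : Finset (Pt d), Set (Fin d × ↥(sites M X) → ℂ)}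
    (hU : ∀ X, IsOpen (U X)) (hg : ∀ X, AnalyticOnNhd ℂ (g X) (U X)) {R E₀ κ : ℝ} (hR : 0 < R) (hE₀ : 0 ≤ E₀)
    (hRU : ∀ X, polydisc (fun _ => R) ⊆ U X)
    (hA : ∀ X : LocDom d, ∀ s ∈ polydisc (fun _ => R), ‖g X.1 s‖ ≤ E₀ * Real.exp (-κ * treeLen X.1))
    (hκ : kappa₀ (4 * 2 ^ d) (2 * d) ≤ κ / 3) (hκ0 : 0 < κ)
    (hwardY : ∀ X : LocDom d, ∀ (μ : Fin d) (x : Pt d) (lam : Pt d → ℝ), (Function.support lam).Finite →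
      ∑' y, ∑ ν, kernelOf M g X.1 μ ν x y * grad lam ν y = 0)
    (hwardX : ∀ X : LocDom d, ∀ (ν : Fin d) (y : Pt d) (lam : Pt d → ℝ), (Function.support lam).Finite →
      ∑' x, ∑ μ, kernelOf M g X.1 μ ν x y * grad lam μ x = 0)
    (hT : TranslInv (threeKernel M (kernelOf M g))) {one two : Fin d} (h12 : two ≠ one) {β : ℝ}
    (hTD : ∀ μ ν, B12Rep537.TaylorData3 (β : ℂ) μ ν
      (B12Form543.ofRealK (Eq363SummedKernel.sumKernel (threeKernel M (kernelOf M g))) μ ν)) :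
    betaPrime (threeKernel M (kernelOf M g)) one two = β :=
  eq364_threeKernel_of_ward hM hd (div_nonneg (mul_nonneg (by norm_num) hE₀) (pow_nonneg hR.le 2)) hκ hκ0
    (fun X μ ν x y h => kernelOf_loc hM X μ ν x y h) (kernelOf_bound hU hg hR hE₀ hRU hA) hwardY hwardX hT h12 hTD

/-! ## §5. (2.27)(iii) for the kernel: the per-domain Ward identities from linearized gauge invariance -/

/-- The second slice derivatives at the centre ARE the second Fréchet derivative on coordinate vectors, for `g` analytic
on an open set containing `0`: `∂_a∂_b g(0) = D²g(0)(e_a)(e_b)`. [folklore] -/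
private theorem pderiv_pderiv_eq_fderiv {ι : Type*} [Fintype ι] [DecidableEq ι] {U : Set (ι → ℂ)} (hU : IsOpen U)
    (h0 : (0 : ι → ℂ) ∈ U) {G : (ι → ℂ) → ℂ} (hG : AnalyticOnNhd ℂ G U) (a b : ι) :
    pderiv a (pderiv b G) 0 = fderiv ℂ (fderiv ℂ G) 0 (Pi.single a 1) (Pi.single b 1) := by
  -- near `0`, `∂_b G` is the Fréchet derivative applied to `e_b`
  have hev : pderiv b G =ᶠ[𝓝 0] fun s => fderiv ℂ G s (Pi.single b 1) := by
    filter_upwards [hU.mem_nhds h0] with s hs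
    exact pderiv_eq_fderiv_apply b (hG s hs).differentiableAt
  have hupd : HasDerivAt (Function.update (0 : ι → ℂ) a) (Pi.single a (1 : ℂ)) 0 := hasDerivAt_update 0 a 0
  have hupd0 : Function.update (0 : ι → ℂ) a 0 = 0 := by
    ext j
    by_cases hj : j = a
    · subst hj; simp
    · simp [hj]
  have htend : Tendsto (Function.update (0 : ι → ℂ) a) (𝓝 0) (𝓝 0) := by
    have h := hupd.continuousAt.tendsto
    rwa [hupd0] at h
  have hev' : (fun t : ℂ => pderiv b G (Function.update 0 a t))
      =ᶠ[𝓝 0] fun t => fderiv ℂ G (Function.update 0 a t) (Pi.single b 1) := htend.eventually hev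
  have hd2 : DifferentiableAt ℂ (fderiv ℂ G) 0 :=
    ((hG 0 h0).contDiffAt.fderiv_right (m := 1) le_rfl).differentiableAt (by simp)
  have hd3 : DifferentiableAt ℂ (fun s => fderiv ℂ G s (Pi.single b 1)) 0 := hd2.clm_apply (differentiableAt_const _)
  have hchain : HasDerivAt (fun t : ℂ => fderiv ℂ G (Function.update 0 a t) (Pi.single b 1))
      (fderiv ℂ (fun s => fderiv ℂ G s (Pi.single b 1)) 0 (Pi.single a 1)) 0 := by
    have h2 : HasFDerivAt (fun s => fderiv ℂ G s (Pi.single b 1))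
        (fderiv ℂ (fun s => fderiv ℂ G s (Pi.single b 1)) 0) (Function.update (0 : ι → ℂ) a 0) := by
      rw [hupd0]
      exact hd3.hasFDerivAt
    exact h2.comp_hasDerivAt (0 : ℂ) hupd
  show deriv (fun t : ℂ => pderiv b G (Function.update 0 a t)) ((0 : ι → ℂ) a) = _
  rw [show (0 : ι → ℂ) a = 0 from rfl, hev'.deriv_eq, hchain.deriv, B12Ward414.fderiv_eval_const hd2]

/-- Symmetry of the second slice derivatives at the centre (analytic ⇒ C², symmetric second derivative). [folklore] -/
private theorem pderiv_comm {ι : Type*} [Fintype ι] [DecidableEq ι] {U : Set (ι → ℂ)} (hU : IsOpen U)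
    (h0 : (0 : ι → ℂ) ∈ U) {G : (ι → ℂ) → ℂ} (hG : AnalyticOnNhd ℂ G U) (a b : ι) :
    pderiv a (pderiv b G) 0 = pderiv b (pderiv a G) 0 := by
  rw [pderiv_pderiv_eq_fderiv hU h0 hG a b, pderiv_pderiv_eq_fderiv hU h0 hG b a,
    (hG 0 h0).contDiffAt.isSymmSndFDerivAt (n := 2) (by simp) (Pi.single a 1) (Pi.single b 1)]

/-- **The pure-gauge direction** `(∂λ)` on the bond components over the sites of `X`: `W_λ(ν, y) = λ(y + e_ν) − λ(y)` (real,
as a complex configuration) — the velocity of the linearized gauge transformation `B ↦ B + t∂λ` of the scalar bond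
components ([I] (4.8)–(4.9) at the unit configuration; `B14.Lem280Ward` (M1)). [cite: Balaban1987RG1, (4.9) p.283] -/
def gaugeDir (M : ℕ) (X : Finset (Pt d)) (lam : Pt d → ℝ) : Fin d × ↥(sites M X) → ℂ :=
  fun p => ((grad lam p.1 p.2.1 : ℝ) : ℂ)

/-- The Hessian of `g X` at `0` annihilates the pure-gauge direction in BOTH slots, when `g X` is analytic near `0` and
locally invariant under `B ↦ B + t∂λ` ((2.27)(iii), linearized): `D²g(0)(v, W_λ) = 0 = D²g(0)(W_λ, v)` — [I] (4.9) ⇒ (4.13)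
for a constant generator field (`B12Ward414.fderiv_apply_eq_zero_of_const_along`, `ward_first_order`) and the symmetry of
second derivatives. [cite: Balaban1987RG1, (4.15) p.284] -/
theorem hessian_gaugeDir_eq_zero {ι : Type*} [Fintype ι] [DecidableEq ι] {U : Set (ι → ℂ)} (hU : IsOpen U)
    (h0 : (0 : ι → ℂ) ∈ U) {G : (ι → ℂ) → ℂ} (hG : AnalyticOnNhd ℂ G U) (W : ι → ℂ)
    (hinv : ∀ᶠ B in 𝓝 (0 : ι → ℂ), ∀ᶠ t in 𝓝 (0 : ℂ), G (B + t • W) = G B) (v : ι → ℂ) :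
    fderiv ℂ (fderiv ℂ G) 0 v W = 0 ∧ fderiv ℂ (fderiv ℂ G) 0 W v = 0 := by
  have hG2 : ContDiffAt ℂ 2 G 0 := (hG 0 h0).contDiffAt
  have hdiff : ∀ᶠ B in 𝓝 (0 : ι → ℂ), DifferentiableAt ℂ G B := by
    filter_upwards [hU.mem_nhds h0] with B hB
    exact (hG B hB).differentiableAt
  have h49 : ∀ᶠ B in 𝓝 (0 : ι → ℂ), fderiv ℂ G B ((fun _ => W) B) = 0 := by
    filter_upwards [hdiff, hinv] with B hB hBinv
    have hγ : HasDerivAt (fun t : ℂ => B + t • W) W 0 := by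
      have h1 : HasDerivAt (fun t : ℂ => t • W) ((1 : ℂ) • W) 0 := (hasDerivAt_id (0 : ℂ)).smul_const W
      rw [one_smul] at h1
      exact h1.const_add B
    exact B12Ward414.fderiv_apply_eq_zero_of_const_along (γ := fun t : ℂ => B + t • W) (by simp) hγ hB
      (by simpa using hBinv)
  have h := B12Ward414.ward_first_order hG2 (differentiableAt_const W) h49 v
  have h1 : fderiv ℂ (fderiv ℂ G) 0 v W = 0 := by
    have e : fderiv ℂ (fun _ : ι → ℂ => W) 0 = 0 := fderiv_const_apply W
    rw [e] at h
    simpa using h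
  exact ⟨h1, by rw [hG2.isSymmSndFDerivAt (by simp) W v]; exact h1⟩

/-- Expansion of the Hessian along coordinate vectors: `D²g(0)(e_a)(W) = Σ_b W_b ∂_a∂_b g(0)`. [folklore] -/
private theorem hessian_expand {ι : Type*} [Fintype ι] [DecidableEq ι] {U : Set (ι → ℂ)} (hU : IsOpen U)
    (h0 : (0 : ι → ℂ) ∈ U) {G : (ι → ℂ) → ℂ} (hG : AnalyticOnNhd ℂ G U) (a : ι) (W : ι → ℂ) :
    fderiv ℂ (fderiv ℂ G) 0 (Pi.single a 1) W = ∑ b, W b * pderiv a (pderiv b G) 0 := by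
  have hW : W = ∑ b, W b • (Pi.single b (1 : ℂ) : ι → ℂ) := by
    conv_lhs => rw [← Finset.univ_sum_single W]
    refine Finset.sum_congr rfl fun b _ => ?_
    rw [← Pi.single_smul, smul_eq_mul, mul_one]
  conv_lhs => rw [hW]
  rw [map_sum]
  refine Finset.sum_congr rfl fun b _ => ?_
  rw [map_smul, smul_eq_mul, pderiv_pderiv_eq_fderiv hU h0 hG a b]

/-- **(2.27)(iii) ⇒ THE KERNEL WARD IDENTITY, `y`-slot** — the hypothesis `hwardY` of `B14.Eq362KernelWard.eq364_threeKernel_of_ward`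
DERIVED: if each `g X` is analytic on an open `U X ∋ 0` and locally invariant under the linearized gauge transformations
`B ↦ B + t∂λ` (every gauge function `λ`), then `Σ_y Σ_ν 𝐄^{(2)}_{μν}(X, x, y, z)(∂_νλ)(y) = 0` for gauge functions of finite
support. [cite: Balaban1988Convergent, (2.27)(iii) p.259, (3.54) p.281] -/
theorem wardY_kernelOf {U : ∀ X : Finset (Pt d), Set (Fin d × ↥(sites M X) → ℂ)}
    (hU : ∀ X, IsOpen (U X)) (h0 : ∀ X, (0 : Fin d × ↥(sites M X) → ℂ) ∈ U X)
    (hg : ∀ X, AnalyticOnNhd ℂ (g X) (U X))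
    (hginv : ∀ (X : Finset (Pt d)) (lam : Pt d → ℝ), ∀ᶠ B in 𝓝 (0 : Fin d × ↥(sites M X) → ℂ), ∀ᶠ t in 𝓝 (0 : ℂ),
      g X (B + t • gaugeDir M X lam) = g X B)
    (X : Finset (Pt d)) (μ : Fin d) (x : Pt d) (lam : Pt d → ℝ) :
    ∑' y, ∑ ν, kernelOf M g X μ ν x y * grad lam ν y = 0 := by
  classical
  have hzero : ∀ y ∉ sites M X, ∑ ν, kernelOf M g X μ ν x y * grad lam ν y = 0 := fun y hy => by
    refine Finset.sum_eq_zero fun ν _ => ?_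
    unfold kernelOf
    rw [dif_neg (fun h => hy h.2), zero_mul]
  rw [tsum_eq_sum (s := sites M X) hzero]
  by_cases hx : x ∈ sites M X
  · set a : Fin d × ↥(sites M X) := (μ, ⟨x, hx⟩) with ha
    -- the finite sum is the real part of the Hessian applied to the pure-gauge direction
    have hsum : ∑ y ∈ sites M X, ∑ ν, kernelOf M g X μ ν x y * grad lam ν y
        = (∑ b : Fin d × ↥(sites M X), gaugeDir M X lam b * pderiv a (pderiv b (g X)) 0).re := by
      rw [← Finset.sum_coe_sort (sites M X), Finset.sum_comm, Complex.re_sum, Fintype.sum_prod_type]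
      refine Finset.sum_congr rfl fun ν _ => Finset.sum_congr rfl fun y _ => ?_
      unfold kernelOf
      rw [dif_pos ⟨hx, y.2⟩]
      simp only [gaugeDir, Complex.mul_re, Complex.ofReal_re, Complex.ofReal_im, zero_mul, sub_zero]
      ring
    rw [hsum, ← hessian_expand (hU X) (h0 X) (hg X) a (gaugeDir M X lam),
      (hessian_gaugeDir_eq_zero (hU X) (h0 X) (hg X) (gaugeDir M X lam) (hginv X lam) (Pi.single a 1)).1,
      Complex.zero_re]
  · refine Finset.sum_eq_zero fun y _ => Finset.sum_eq_zero fun ν _ => ?_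
    unfold kernelOf
    rw [dif_neg (fun h => hx h.1), zero_mul]

/-- **(2.27)(iii) ⇒ THE KERNEL WARD IDENTITY, `x`-slot** (`hwardX` of `B14.Eq362KernelWard.eq364_threeKernel_of_ward`):
`Σ_x Σ_μ 𝐄^{(2)}_{μν}(X, x, y, z)(∂_μλ)(x) = 0`, by the symmetry of second derivatives. [cite: Balaban1988Convergent, (2.27)(iii) p.259, (3.54) p.281] -/
theorem wardX_kernelOf {U : ∀ X : Finset (Pt d), Set (Fin d × ↥(sites M X) → ℂ)}
    (hU : ∀ X, IsOpen (U X)) (h0 : ∀ X, (0 : Fin d × ↥(sites M X) → ℂ) ∈ U X)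
    (hg : ∀ X, AnalyticOnNhd ℂ (g X) (U X))
    (hginv : ∀ (X : Finset (Pt d)) (lam : Pt d → ℝ), ∀ᶠ B in 𝓝 (0 : Fin d × ↥(sites M X) → ℂ), ∀ᶠ t in 𝓝 (0 : ℂ),
      g X (B + t • gaugeDir M X lam) = g X B)
    (X : Finset (Pt d)) (ν : Fin d) (y : Pt d) (lam : Pt d → ℝ) :
    ∑' x, ∑ μ, kernelOf M g X μ ν x y * grad lam μ x = 0 := by
  classical
  have hzero : ∀ x ∉ sites M X, ∑ μ, kernelOf M g X μ ν x y * grad lam μ x = 0 := fun x hx => by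
    refine Finset.sum_eq_zero fun μ _ => ?_
    unfold kernelOf
    rw [dif_neg (fun h => hx h.1), zero_mul]
  rw [tsum_eq_sum (s := sites M X) hzero]
  by_cases hy : y ∈ sites M X
  · set b : Fin d × ↥(sites M X) := (ν, ⟨y, hy⟩) with hb
    have hsum : ∑ x ∈ sites M X, ∑ μ, kernelOf M g X μ ν x y * grad lam μ x
        = (∑ a : Fin d × ↥(sites M X), gaugeDir M X lam a * pderiv b (pderiv a (g X)) 0).re := by
      rw [← Finset.sum_coe_sort (sites M X), Finset.sum_comm, Complex.re_sum, Fintype.sum_prod_type]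
      refine Finset.sum_congr rfl fun μ _ => Finset.sum_congr rfl fun x _ => ?_
      unfold kernelOf
      rw [dif_pos ⟨x.2, hy⟩, pderiv_comm (hU X) (h0 X) (hg X) (μ, (⟨x.1, x.2⟩ : ↥(sites M X))) b]
      simp only [gaugeDir, Complex.mul_re, Complex.ofReal_re, Complex.ofReal_im, zero_mul, sub_zero]
      ring
    rw [hsum, ← hessian_expand (hU X) (h0 X) (hg X) b (gaugeDir M X lam),
      (hessian_gaugeDir_eq_zero (hU X) (h0 X) (hg X) (gaugeDir M X lam) (hginv X lam) (Pi.single b 1)).1,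
      Complex.zero_re]
  · refine Finset.sum_eq_zero fun x _ => Finset.sum_eq_zero fun μ _ => ?_
    unfold kernelOf
    rw [dif_neg (fun h => hy h.2), zero_mul]

/-- **`β′_j = β_j` ((3.61)–(3.64)) FROM THE PRINTED PER-DOMAIN DATA (2.27)(i)–(iv)** — for the whole-lattice kernel of a
localization expansion whose terms have analytic extensions `g X` on open sets containing the closed polydisc of radius
`R`, bounded there by `E₀e^{−κd_j(X)}` ((I.1.18), `κ/3 ≥ κ₀(4·2^d, 2d)`), locally invariant under the linearized gauge
transformations: `B14.Eq362KernelWard.eq364_threeKernel_of_ward` with `hloc`, `hbd`, `hwardY`, `hwardX` ALL DISCHARGED — what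
remains is translation invariance (p. 281) and [I]'s Taylor data (I.5.16) of the summed kernel (3.63).
[cite: Balaban1988Convergent, (3.64) p.283] -/
theorem eq364_kernelOf (hM : 0 < M) (hd : 0 < d) {U : ∀ X : Finset (Pt d), Set (Fin d × ↥(sites M X) → ℂ)}
    (hU : ∀ X, IsOpen (U X)) (hg : ∀ X, AnalyticOnNhd ℂ (g X) (U X)) {R E₀ κ : ℝ} (hR : 0 < R) (hE₀ : 0 ≤ E₀)
    (hRU : ∀ X, polydisc (fun _ => R) ⊆ U X)
    (hA : ∀ X : LocDom d, ∀ s ∈ polydisc (fun _ => R), ‖g X.1 s‖ ≤ E₀ * Real.exp (-κ * treeLen X.1))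
    (hκ : kappa₀ (4 * 2 ^ d) (2 * d) ≤ κ / 3) (hκ0 : 0 < κ)
    (hginv : ∀ (X : Finset (Pt d)) (lam : Pt d → ℝ), ∀ᶠ B in 𝓝 (0 : Fin d × ↥(sites M X) → ℂ), ∀ᶠ t in 𝓝 (0 : ℂ),
      g X (B + t • gaugeDir M X lam) = g X B)
    (hT : TranslInv (threeKernel M (kernelOf M g))) {one two : Fin d} (h12 : two ≠ one) {β : ℝ}
    (hTD : ∀ μ ν, B12Rep537.TaylorData3 (β : ℂ) μ ν
      (B12Form543.ofRealK (Eq363SummedKernel.sumKernel (threeKernel M (kernelOf M g))) μ ν)) :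
    betaPrime (threeKernel M (kernelOf M g)) one two = β :=
  have h0 : ∀ X, (0 : Fin d × ↥(sites M X) → ℂ) ∈ U X := fun X => hRU X (zero_mem_polydisc fun _ => hR.le)
  eq364_kernelOf_of_ward hM hd hU hg hR hE₀ hRU hA hκ hκ0
    (fun X μ x lam _ => wardY_kernelOf hU h0 hg hginv X.1 μ x lam)
    (fun X ν y lam _ => wardX_kernelOf hU h0 hg hginv X.1 ν y lam) hT h12 hTD

end

end Literature.MathematicalPhysics.QuantumFieldTheory.Balaban1983to89.B14.Eq350KernelCauchy
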